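import Summits.Ventures.CertifiedManyBodySolver.Theorems.TcThermcert1FreeGasCurrentClustering
import Summits.Ventures.CertifiedManyBodySolver.Theorems.TcThermcert1FugacityProjection
import Literature.MathematicalPhysics.QuantumLattice.HubbardNNNHoppingFluxThermal
import Literature.MathematicalPhysics.QuantumLattice.FermionLiebRobinson
import Literature.MathematicalPhysics.QuantumLattice.FermionTraceFactorization
import Literature.MathematicalPhysics.QuantumLattice.LatticeTori
import HarnessLib

/-!
# `FreeCanonicalB8` — sketch for the crux idea `free-canonical-b8-rung` (hubbard-floor-idea-rescuer g15, lens A + rescuer)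

Crux: K1 = `TcThermcert1.ThermalStiffnessCeilingU8b10_le_1o8` (stmt-Ventures-26381) / K1′ (stmt-Ventures-24560); THE BET of the
registered line `Lines/gauge_qbp_far_seam.lean` v1.6 is `stub_currentClustering8 : ∃ ξ, CurrentClustering 8 (7/8) 8 ξ`.
This file types the **`U = 0` rung of Hypothesis C at the bet's own `(β, n) = (8, 7/8)`** — named OPEN in the K1′
`Disproof.lean` ed.3 HANDOFF («genuinely hard because the free CANONICAL state is not quasi-free») and in
`Theorems/TcThermcert1FreeGasCurrentClustering.lean` («the degenerate regime … needs saddle-point control of the fugacity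
integral with observable insertions») — together with the first lemmas of a saddle-FREE scheme:
(S1) time reversal at COMPLEX two-fugacity (no plateau term), (S2) exact Gaussian domination of the Fermi–Dirac fugacity
polynomial on the circle, (S3) Bobkov–Marsiglietti–Melbourne anti-concentration at a mode, (S4) good-arc propagator decay.
Honest label: a RUNG (U = 0); decides nothing about C8 at `U = 8`, about K1/K1′, `T_c`, or superconductivity in the Hubbard model.
`sorry` only inside `stub_*`.
-/

noncomputable section

namespace Summit.Ventures.CertifiedManyBodySolver.Cruxes.ThermalStiffnessCeilingU8b10_le_1o8.FreeCanonicalB8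

open Filter Topology Real Matrix Finset
open Literature.MathematicalPhysics.QuantumLattice
open Literature.Probability.LatticeModels
open scoped Matrix.Norms.L2Operator ComplexOrder ComplexConjugate

/-! ## §0 Objects — VERBATIM copy of `Lines/gauge_qbp_far_seam.lean` v1.6 §0–§1 (`FockOp`, `sectorPred`, `SectorPreserving`,
`sectorExpect`, `bondCurrent`, `CurrentClustering`), exactly as the K1′ `Disproof.lean` copies them, so that this sketch elaborates on
main-build imports only (the `Lines` module is not in the farm build); `FreeCanonicalRungB8` below is literally the line's
`∃ ξ, CurrentClustering 0 (7/8) 8 ξ` with the namespace prefix exchanged. -/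

section Objects

variable (L : ℕ) [NeZero L]

/-- (copy) Operators on the fermionic Fock space of the two-spin torus. -/
abbrev FockOp : Type := Matrix (Finset (Orb (FermionTorus 2 L))) (Finset (Orb (FermionTorus 2 L))) ℂ

/-- (copy) The canonical `(N_L, S^z = 0)` coordinate sector at hole density `δ`. -/
abbrev sectorPred (δ : ℝ) : Finset (Orb (FermionTorus 2 L)) → Prop :=
  fun s => s.card = 2 * ⌊(1 - δ) * (L : ℝ) ^ 2 / 2⌋₊ ∧
    2 * (s.filter fun i => (ofLex i).2 = 0).card = 2 * ⌊(1 - δ) * (L : ℝ) ^ 2 / 2⌋₊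

/-- (copy) Sector-preserving operator. -/
def SectorPreserving (δ : ℝ) (A : FockOp L) : Prop :=
  ∀ s t, sectorPred L δ s → ¬ sectorPred L δ t → A s t = 0 ∧ A t s = 0

/-- (copy) Canonical-sector Gibbs expectation. -/
def sectorExpect (δ β : ℝ) (H A : FockOp L) : ℂ :=
  gibbsState β (H.toBlock (sectorPred L δ) (sectorPred L δ)) (A.toBlock (sectorPred L δ) (sectorPred L δ))

/-- (copy) The plain bond current on `(X−1,y) → (X,y)`, both spins. -/
def bondCurrent (X y : ZMod L) : FockOp L :=
  ∑ σ : Fin 2,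
    ((-Complex.I) • (creation (orb (FermionTorus.ofTorusSite ![X, y]) σ) *
        annihilation (orb (FermionTorus.ofTorusSite ![X - 1, y]) σ)) +
      Complex.I • (creation (orb (FermionTorus.ofTorusSite ![X - 1, y]) σ) *
        annihilation (orb (FermionTorus.ofTorusSite ![X, y]) σ)))

end Objects

/-- (copy) **Hypothesis C** — uniform exponential clustering of the flux-free canonical sector Gibbs state against the cut currents. -/
def CurrentClustering (U n β ξ : ℝ) : Prop :=
  0 < ξ ∧ ∃ C : ℝ, ∃ k L₀ : ℕ, ∀ (L : ℕ) [NeZero L], L₀ ≤ L →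
    ∀ (X : Finset (FermionTorus 2 L)) (A : FockOp L),
      A ∈ carEvenSubalgebra (orbSet X) → SectorPreserving L (1 - n) A →
      ∀ (X₀ y : ZMod L) (d : ℕ),
        (∀ x ∈ X, d ≤ torusDist x.toTorusSite ![X₀, y] ∧
          d ≤ torusDist x.toTorusSite ![X₀ - 1, y]) →
        ‖sectorExpect L (1 - n) β (hubbardTorusTT'Flux L 0 U 0) (A * bondCurrent L X₀ y)
            - sectorExpect L (1 - n) β (hubbardTorusTT'Flux L 0 U 0) A
              * sectorExpect L (1 - n) β (hubbardTorusTT'Flux L 0 U 0) (bondCurrent L X₀ y)‖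
          ≤ C * ‖A‖ * (X.card : ℝ) ^ k * Real.exp (-(d : ℝ) / ξ)

/-! ## The rung (target) and its sub-extensive ladder -/

/-- **R — the `U = 0` rung of Hypothesis C at `(β, n) = (8, 7/8)`** (full strength, every observable support `X`). OPEN. -/
def FreeCanonicalRungB8 : Prop := ∃ ξ : ℝ, CurrentClustering 0 (7 / 8) 8 ξ

/-- **R(s) — the rung restricted to supports `|X| ≤ L^s`.** The scheme S1–S4 is claimed for every `s < 2`
(it needs `|X| · log L ≪ σ_L² ≍ L²` on the bad arc); `R(2)` is `R` (`|X| ≤ L²` always, `rung_of_sub_two`). -/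
def FreeCanonicalRungB8Sub (s : ℝ) : Prop :=
  ∃ ξ : ℝ, 0 < ξ ∧ ∃ C : ℝ, ∃ k L₀ : ℕ, ∀ (L : ℕ) [NeZero L], L₀ ≤ L →
    ∀ (X : Finset (FermionTorus 2 L)) (A : FockOp L), (X.card : ℝ) ≤ (L : ℝ) ^ s →
      A ∈ carEvenSubalgebra (orbSet X) → SectorPreserving L (1 - 7 / 8) A →
      ∀ (X₀ y : ZMod L) (d : ℕ),
        (∀ x ∈ X, d ≤ torusDist x.toTorusSite ![X₀, y] ∧
          d ≤ torusDist x.toTorusSite ![X₀ - 1, y]) →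
        ‖sectorExpect L (1 - 7 / 8) 8 (hubbardTorusTT'Flux L 0 0 0) (A * bondCurrent L X₀ y)
            - sectorExpect L (1 - 7 / 8) 8 (hubbardTorusTT'Flux L 0 0 0) A
              * sectorExpect L (1 - 7 / 8) 8 (hubbardTorusTT'Flux L 0 0 0) (bondCurrent L X₀ y)‖
          ≤ C * ‖A‖ * (X.card : ℝ) ^ k * Real.exp (-(d : ℝ) / ξ)

/-- `R(2) → R`: a support on the `L × L` torus has at most `L²` sites. -/
theorem rung_of_sub_two : FreeCanonicalRungB8Sub 2 → FreeCanonicalRungB8 := by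
  rintro ⟨ξ, hξ, C, k, L₀, h⟩
  refine ⟨ξ, hξ, C, k, L₀, fun L _ hL X A hA hS X₀ y d hd => ?_⟩
  have hX : (X.card : ℝ) ≤ (L : ℝ) ^ (2 : ℝ) := by
    have h1 : X.card ≤ Fintype.card (FermionTorus 2 L) := Finset.card_le_univ X
    rw [card_fermionTorus] at h1
    rw [Real.rpow_two]
    exact_mod_cast h1
  exact h L hL X A hX hA hS X₀ y d hd

/-! ## S1 — time reversal at complex two-fugacity: the current has zero weight in EVERY fugacity-twisted trace
(so the sector covariance numerator has no `ω(A)·ω(j)` plateau term, F1/F6 of the K1′ Disproof honoured at the integrand level). -/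

/-- S1: `tr( diag(z^{N↑} w^{N↓}) e^{−βH₀} j_{X₀,y} ) = 0` for all complex `z, w` (free torus, no flux).
Support-level: linear combination over `(M,N)` of the tree's `trace_current_eq_zero`. -/
theorem stub_fugacityTrace_current_eq_zero (L : ℕ) [NeZero L] (β : ℝ) (z w : ℂ) (X₀ y : ZMod L) :
    (Matrix.diagonal (fun s : Finset (Orb (FermionTorus 2 L)) => z ^ (upPart s).card * w ^ (downPart s).card) *
        gibbsWeight β (hubbardTorusTT'Flux L 0 0 0) * bondCurrent L X₀ y).trace = 0 := by
  sorry

/-! ## S2 — FIRST LEMMA: exact Gaussian domination of the Fermi–Dirac fugacity polynomial on the circle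
`|∏(1 + w_k e^{iφ})| ≤ ∏(1 + w_k) · exp(−(1 − cos φ) Σ w_k/(1 + w_k)²)` (all roots on the negative real axis;
`w/(1+w)² = p(1−p)`, so the exponent is `(1 − cos φ)·Var N`). -/

/-- S2, one factor: `‖1 + w e^{iφ}‖² = (1 + w)² − 2w(1 − cos φ)`. -/
theorem normSq_one_add_mul_exp (w φ : ℝ) :
    ‖(1 : ℂ) + (w : ℂ) * Complex.exp (φ * Complex.I)‖ ^ 2 = (1 + w) ^ 2 - 2 * w * (1 - Real.cos φ) := by
  rw [Complex.sq_norm, Complex.normSq_apply]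
  have hre : ((1 : ℂ) + (w : ℂ) * Complex.exp (φ * Complex.I)).re = 1 + w * Real.cos φ := by
    simp [Complex.exp_ofReal_mul_I_re]
  have him : ((1 : ℂ) + (w : ℂ) * Complex.exp (φ * Complex.I)).im = w * Real.sin φ := by
    simp [Complex.exp_ofReal_mul_I_im]
  rw [hre, him]
  linear_combination (w ^ 2) * Real.sin_sq_add_cos_sq φ

/-- S2, one factor, dominated form: `‖1 + w e^{iφ}‖ ≤ (1 + w) exp(−(1 − cos φ) w/(1+w)²)` for `w ≥ 0`. -/
theorem norm_one_add_mul_exp_le (w φ : ℝ) (hw : 0 ≤ w) :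
    ‖(1 : ℂ) + (w : ℂ) * Complex.exp (φ * Complex.I)‖ ≤ (1 + w) * Real.exp (-((1 - Real.cos φ) * (w / (1 + w) ^ 2))) := by
  have h1w : 0 < 1 + w := by linarith
  set u : ℝ := (1 - Real.cos φ) * (w / (1 + w) ^ 2) with hu
  have hu0 : 0 ≤ u := by
    have := Real.cos_le_one φ
    positivity
  -- squared inequality: ‖·‖² = (1+w)²(1 − 2u) ≤ (1+w)² exp(−2u)
  have hsq : ‖(1 : ℂ) + (w : ℂ) * Complex.exp (φ * Complex.I)‖ ^ 2 ≤ ((1 + w) * Real.exp (-u)) ^ 2 := by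
    rw [normSq_one_add_mul_exp, mul_pow, ← Real.exp_nat_mul]
    have hexp : 1 - 2 * u ≤ Real.exp ((2 : ℕ) * -u) := by
      have := Real.add_one_le_exp ((2 : ℕ) * -u)
      push_cast at this ⊢
      linarith
    have hid : (1 + w) ^ 2 - 2 * w * (1 - Real.cos φ) = (1 + w) ^ 2 * (1 - 2 * u) := by
      have h1w' : (1 + w) ^ 2 ≠ 0 := by positivity
      rw [hu]
      field_simp
    rw [hid]
    exact mul_le_mul_of_nonneg_left hexp (by positivity)
  have hR : 0 ≤ (1 + w) * Real.exp (-u) := by positivity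
  by_contra hlt
  push Not at hlt
  nlinarith [hsq, hlt, hR, norm_nonneg ((1 : ℂ) + (w : ℂ) * Complex.exp (φ * Complex.I))]

/-- **S2 (first lemma).** Gaussian domination of the Fermi–Dirac fugacity polynomial on the circle. -/
theorem fugacityCircle_domination {ι : Type*} (s : Finset ι) (w : ι → ℝ) (hw : ∀ k ∈ s, 0 ≤ w k) (φ : ℝ) :
    ‖∏ k ∈ s, ((1 : ℂ) + (w k : ℂ) * Complex.exp (φ * Complex.I))‖
      ≤ (∏ k ∈ s, (1 + w k)) * Real.exp (-((1 - Real.cos φ) * ∑ k ∈ s, w k / (1 + w k) ^ 2)) := by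
  classical
  induction s using Finset.induction_on with
  | empty => simp
  | insert a s ha ih =>
    rw [Finset.prod_insert ha, Finset.prod_insert ha, Finset.sum_insert ha, norm_mul, mul_add, neg_add,
      Real.exp_add]
    have h1 := norm_one_add_mul_exp_le (w a) φ (hw a (Finset.mem_insert_self a s))
    have h2 := ih fun k hk => hw k (Finset.mem_insert_of_mem hk)
    calc ‖(1 : ℂ) + (w a : ℂ) * Complex.exp (φ * Complex.I)‖ * ‖∏ k ∈ s, ((1 : ℂ) + (w k : ℂ) * Complex.exp (φ * Complex.I))‖
        ≤ ((1 + w a) * Real.exp (-((1 - Real.cos φ) * (w a / (1 + w a) ^ 2)))) *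
            ((∏ k ∈ s, (1 + w k)) * Real.exp (-((1 - Real.cos φ) * ∑ k ∈ s, w k / (1 + w k) ^ 2))) :=
          mul_le_mul h1 h2 (norm_nonneg _) (by
            have := hw a (Finset.mem_insert_self a s); positivity)
      _ = _ := by ring

/-! ## S3 — anti-concentration of the Poisson-binomial sector weight AT A MODE (Bobkov–Marsiglietti–Melbourne 2021,
Thm 1.1 / eq. (3.2): `max_k P(N = k) ≥ 1/√(1 + 12 Var N)` for every integer-valued `N`; the radius `r` is chosen so that the
target sector `N₀` is a mode and no Fermi–Dirac factor sits exactly at a pole, `r a_k ≠ 1`). -/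

/-- S3: for positive weights `a_k` and a target `N₀ ≤ #levels` there is a radius `r > 0`, off every pole, at which the
normalised `N₀`-th elementary symmetric function (`= P_r(N = N₀)`) is at least `1/√(1 + 12 σ_r²)`. -/
theorem stub_sectorWeight_at_mode {ι : Type*} [Fintype ι] [DecidableEq ι] (a : ι → ℝ) (ha : ∀ k, 0 < a k)
    (N₀ : ℕ) (hN : N₀ ≤ Fintype.card ι) :
    ∃ r : ℝ, 0 < r ∧ (∀ k, r * a k ≠ 1) ∧
      (∏ k, (1 + r * a k)) / Real.sqrt (1 + 12 * ∑ k, (r * a k) / (1 + r * a k) ^ 2)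
        ≤ ∑ S ∈ (Finset.univ : Finset ι).powersetCard N₀, ∏ k ∈ S, r * a k := by
  sorry

/-! ## S4 — good-arc decay of the complex-fugacity free propagator on the torus, uniform in `L`
(`G_ζ(x−y) = L⁻² Σ_k e^{ik·(x−y)} ζ e^{−βε_k}/(1 + ζ e^{−βε_k})`, `ζ = r e^{iφ}`, `|φ| ≤ φ₀ < π`; Poisson aliasing + a
contour shift by the strip half-width `a` with `4tβ·sinh a < π − φ₀`). -/

/-- S4: uniform-in-`L` exponential decay in torus distance of the fugacity-twisted Fermi–Dirac kernel on the good arc. -/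
theorem stub_arcPropagator_decay (β r φ₀ : ℝ) (hβ : 0 < β) (hr : 0 < r) (hφ₀ : 0 ≤ φ₀) (hφ₀' : φ₀ < Real.pi) :
    ∃ C ξ : ℝ, 0 < ξ ∧ ∀ (L : ℕ) [NeZero L] (φ : ℝ), |φ| ≤ φ₀ → ∀ x y : TorusSite 2 L,
      ‖(1 / ((L : ℂ) ^ 2)) * ∑ k : TorusSite 2 L,
          Complex.exp (2 * Real.pi * Complex.I *
              ((((k 0).val : ℤ) * (((x 0).val : ℤ) - (y 0).val) + ((k 1).val : ℤ) * (((x 1).val : ℤ) - (y 1).val) : ℤ) : ℂ) / (L : ℂ)) *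
            (((r * Real.exp (-(β * (-2 * (Real.cos (2 * Real.pi * (k 0).val / L) + Real.cos (2 * Real.pi * (k 1).val / L))))) : ℝ) : ℂ) *
                Complex.exp (φ * Complex.I) /
              (1 + ((r * Real.exp (-(β * (-2 * (Real.cos (2 * Real.pi * (k 0).val / L) + Real.cos (2 * Real.pi * (k 1).val / L))))) : ℝ) : ℂ) *
                Complex.exp (φ * Complex.I)))‖
        ≤ C * Real.exp (-(torusDist (Ls := fun _ : Fin 2 => L) x y : ℝ) / ξ) := by
  sorry

end Summit.Ventures.CertifiedManyBodySolver.Cruxes.ThermalStiffnessCeilingU8b10_le_1o8.FreeCanonicalB8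

end
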